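import Literature.NumberTheory.NumberFields.BhargavaQuinticSpaceOrbit
import Mathlib.LinearAlgebra.Eigenspace.Minpoly
import Mathlib.LinearAlgebra.Dual.Lemmas
import Mathlib.Algebra.MvPolynomial.Funext
import Mathlib.RingTheory.MvPolynomial.Basic
import HarnessLib

/-!
# Bhargava's quintic space: kernel identities and the eigenvector lemma

Support file for the named fact
`Literature.NumberTheory.NumberFields.BhargavaQuinticSpace.WrightYukie1992_orbit_bijective_etaleQuintic`
(file `BhargavaQuinticSpace.lean`), towards part (b), direction ⟸ (isomorphic quintic algebras ⟹
same orbit).  Everything here is PROVED.  Linear-algebra facts about an alternating `5 × 5` matrix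
`X` and its vector `Q(X)` of signed `4 × 4` sub-Pfaffians:

* `mulVec_subPfVec_of_mem_altMatrix`, `subPfVec_vecMul_of_mem_altMatrix`: `X · Q(X) = 0 = Q(X) · X`
  (each row of the pencil `A(t)` is a linear syzygy of the five quadrics `Qᵢ(A)`);
* `mul_subPfVec_comm_of_vecMul_eq_zero` (**left-kernel lemma**): `v ᵥ* X = 0 ⟹ vᵢ Qⱼ = vⱼ Qᵢ`, from
  the ten identities `vᵢQⱼ - vⱼQᵢ = (v ᵥ* X) ⬝ α⁽ⁱʲ⁾` with `α⁽ⁱʲ⁾ₖ = ± X_{lm}`, `{i,j,k,l,m} = {1,…,5}`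
  (`altFive_lker_ij`); hence the left kernel of `X` is the line `K · Q(X)` when `Q(X) ≠ 0`
  (`exists_eq_smul_subPfVec_of_vecMul_eq_zero`);
* `eq_zero_of_forall_vecMul_eq_zero`: if the five quadrics `Qᵢ(A)` are linearly independent, the
  `Aᵢ` have no common non-zero left-kernel vector;
* `pencilPoly`, `subPfaffianPoly`, `eval_subPfaffianPoly`: the quadrics as honest polynomials in
  `K[X₀, …, X₃]`;
* `exists_eq_smul_one_of_mulVec_parallel` (**eigenvector lemma**): over an infinite field, if the
  `Qᵢ(A)` are linearly independent and `N · Q(A)(t) ∥ Q(A)(t)` for all `t`, then `N` is a scalar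
  matrix (the image of `t ↦ Q(A)(t)` does not lie in the finite union of the eigenspaces of a
  non-scalar `N`, by `MvPolynomial.funext`).

## References

* M. Bhargava, *Higher composition laws IV*, Ann. of Math. 167 (2008), 53–94, §2, (8). [Bhargava2008]
* A. Yukie, *Shintani Zeta Functions*, LMS LNS 183, CUP (1993), §0.4 Thm (0.4.2). [Yukie1993]
-/

noncomputable section

open Matrix
open scoped LinearAlgebra.Projectivization

namespace Literature.NumberTheory.NumberFields
namespace BhargavaQuinticSpace

universe u

variable {R : Type*} [CommRing R]

/-! ### `X · Q(X) = 0` and the left-kernel identities -/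

/-- `X · Q(X) = 0` for the explicit alternating `5 × 5` matrix. [folklore] -/
theorem altFive_mulVec_subPfVec (a b c d e f g p q r : R) :
    altFive a b c d e f g p q r *ᵥ subPfVec (altFive a b c d e f g p q r) = 0 := by
  ext i
  fin_cases i <;>
  simp [mulVec, dotProduct, Fin.sum_univ_five, subPfVec_apply_zero, subPfVec_apply_one,
    subPfVec_apply_two, subPfVec_apply_three, subPfVec_apply_four, altFive] <;> ring

/-- `X · Q(X) = 0`: the vector of signed sub-Pfaffians of an alternating `5 × 5` matrix lies in its
kernel. [folklore] -/
theorem mulVec_subPfVec_of_mem_altMatrix {X : Matrix (Fin 5) (Fin 5) R} (hX : X ∈ altMatrix (Fin 5) R) :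
    X *ᵥ subPfVec X = 0 := by
  rw [eq_altFive_of_mem_altMatrix hX]
  exact altFive_mulVec_subPfVec _ _ _ _ _ _ _ _ _ _

/-- `Q(X) · X = 0`. [folklore] -/
theorem subPfVec_vecMul_of_mem_altMatrix {X : Matrix (Fin 5) (Fin 5) R} (hX : X ∈ altMatrix (Fin 5) R) :
    subPfVec X ᵥ* X = 0 := by
  rw [← mulVec_transpose, hX.1, neg_mulVec, mulVec_subPfVec_of_mem_altMatrix hX, neg_zero]

/-- Left-kernel identity `(0,1)`: `v ᵥ* X = 0 ⟹ vᵢ Qⱼ = vⱼ Qᵢ` for the explicit alternating matrix.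
[folklore] -/
theorem altFive_lker_01 (a b c d e f g p q r : R) (v : Fin 5 → R)
    (hv : v ᵥ* altFive a b c d e f g p q r = 0) :
    v 0 * subPfVec (altFive a b c d e f g p q r) 1 = v 1 * subPfVec (altFive a b c d e f g p q r) 0 := by
  have h0 := congrFun hv 0
  have h1 := congrFun hv 1
  have h2 := congrFun hv 2
  have h3 := congrFun hv 3
  have h4 := congrFun hv 4
  simp [vecMul, dotProduct, Fin.sum_univ_five, altFive] at h0 h1 h2 h3 h4
  simp [subPfVec_apply_zero, subPfVec_apply_one, altFive]
  linear_combination (-r) * h2 + (q) * h3 + (-p) * h4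

/-- Left-kernel identity `(0,2)`: `v ᵥ* X = 0 ⟹ vᵢ Qⱼ = vⱼ Qᵢ` for the explicit alternating matrix.
[folklore] -/
theorem altFive_lker_02 (a b c d e f g p q r : R) (v : Fin 5 → R)
    (hv : v ᵥ* altFive a b c d e f g p q r = 0) :
    v 0 * subPfVec (altFive a b c d e f g p q r) 2 = v 2 * subPfVec (altFive a b c d e f g p q r) 0 := by
  have h0 := congrFun hv 0
  have h1 := congrFun hv 1
  have h2 := congrFun hv 2
  have h3 := congrFun hv 3
  have h4 := congrFun hv 4
  simp [vecMul, dotProduct, Fin.sum_univ_five, altFive] at h0 h1 h2 h3 h4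
  simp [subPfVec_apply_zero, subPfVec_apply_two, altFive]
  linear_combination (r) * h1 + (-g) * h3 + (f) * h4

/-- Left-kernel identity `(0,3)`: `v ᵥ* X = 0 ⟹ vᵢ Qⱼ = vⱼ Qᵢ` for the explicit alternating matrix.
[folklore] -/
theorem altFive_lker_03 (a b c d e f g p q r : R) (v : Fin 5 → R)
    (hv : v ᵥ* altFive a b c d e f g p q r = 0) :
    v 0 * subPfVec (altFive a b c d e f g p q r) 3 = v 3 * subPfVec (altFive a b c d e f g p q r) 0 := by
  have h0 := congrFun hv 0
  have h1 := congrFun hv 1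
  have h2 := congrFun hv 2
  have h3 := congrFun hv 3
  have h4 := congrFun hv 4
  simp [vecMul, dotProduct, Fin.sum_univ_five, altFive] at h0 h1 h2 h3 h4
  simp [subPfVec_apply_zero, subPfVec_apply_three, altFive]
  linear_combination (-q) * h1 + (g) * h2 + (-e) * h4

/-- Left-kernel identity `(0,4)`: `v ᵥ* X = 0 ⟹ vᵢ Qⱼ = vⱼ Qᵢ` for the explicit alternating matrix.
[folklore] -/
theorem altFive_lker_04 (a b c d e f g p q r : R) (v : Fin 5 → R)
    (hv : v ᵥ* altFive a b c d e f g p q r = 0) :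
    v 0 * subPfVec (altFive a b c d e f g p q r) 4 = v 4 * subPfVec (altFive a b c d e f g p q r) 0 := by
  have h0 := congrFun hv 0
  have h1 := congrFun hv 1
  have h2 := congrFun hv 2
  have h3 := congrFun hv 3
  have h4 := congrFun hv 4
  simp [vecMul, dotProduct, Fin.sum_univ_five, altFive] at h0 h1 h2 h3 h4
  simp [subPfVec_apply_zero, subPfVec_apply_four, altFive]
  linear_combination (p) * h1 + (-f) * h2 + (e) * h3

/-- Left-kernel identity `(1,2)`: `v ᵥ* X = 0 ⟹ vᵢ Qⱼ = vⱼ Qᵢ` for the explicit alternating matrix.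
[folklore] -/
theorem altFive_lker_12 (a b c d e f g p q r : R) (v : Fin 5 → R)
    (hv : v ᵥ* altFive a b c d e f g p q r = 0) :
    v 1 * subPfVec (altFive a b c d e f g p q r) 2 = v 2 * subPfVec (altFive a b c d e f g p q r) 1 := by
  have h0 := congrFun hv 0
  have h1 := congrFun hv 1
  have h2 := congrFun hv 2
  have h3 := congrFun hv 3
  have h4 := congrFun hv 4
  simp [vecMul, dotProduct, Fin.sum_univ_five, altFive] at h0 h1 h2 h3 h4
  simp [subPfVec_apply_one, subPfVec_apply_two, altFive]
  linear_combination (-r) * h0 + (d) * h3 + (-c) * h4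

/-- Left-kernel identity `(1,3)`: `v ᵥ* X = 0 ⟹ vᵢ Qⱼ = vⱼ Qᵢ` for the explicit alternating matrix.
[folklore] -/
theorem altFive_lker_13 (a b c d e f g p q r : R) (v : Fin 5 → R)
    (hv : v ᵥ* altFive a b c d e f g p q r = 0) :
    v 1 * subPfVec (altFive a b c d e f g p q r) 3 = v 3 * subPfVec (altFive a b c d e f g p q r) 1 := by
  have h0 := congrFun hv 0
  have h1 := congrFun hv 1
  have h2 := congrFun hv 2
  have h3 := congrFun hv 3
  have h4 := congrFun hv 4
  simp [vecMul, dotProduct, Fin.sum_univ_five, altFive] at h0 h1 h2 h3 h4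
  simp [subPfVec_apply_one, subPfVec_apply_three, altFive]
  linear_combination (q) * h0 + (-d) * h2 + (b) * h4

/-- Left-kernel identity `(1,4)`: `v ᵥ* X = 0 ⟹ vᵢ Qⱼ = vⱼ Qᵢ` for the explicit alternating matrix.
[folklore] -/
theorem altFive_lker_14 (a b c d e f g p q r : R) (v : Fin 5 → R)
    (hv : v ᵥ* altFive a b c d e f g p q r = 0) :
    v 1 * subPfVec (altFive a b c d e f g p q r) 4 = v 4 * subPfVec (altFive a b c d e f g p q r) 1 := by
  have h0 := congrFun hv 0
  have h1 := congrFun hv 1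
  have h2 := congrFun hv 2
  have h3 := congrFun hv 3
  have h4 := congrFun hv 4
  simp [vecMul, dotProduct, Fin.sum_univ_five, altFive] at h0 h1 h2 h3 h4
  simp [subPfVec_apply_one, subPfVec_apply_four, altFive]
  linear_combination (-p) * h0 + (c) * h2 + (-b) * h3

/-- Left-kernel identity `(2,3)`: `v ᵥ* X = 0 ⟹ vᵢ Qⱼ = vⱼ Qᵢ` for the explicit alternating matrix.
[folklore] -/
theorem altFive_lker_23 (a b c d e f g p q r : R) (v : Fin 5 → R)
    (hv : v ᵥ* altFive a b c d e f g p q r = 0) :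
    v 2 * subPfVec (altFive a b c d e f g p q r) 3 = v 3 * subPfVec (altFive a b c d e f g p q r) 2 := by
  have h0 := congrFun hv 0
  have h1 := congrFun hv 1
  have h2 := congrFun hv 2
  have h3 := congrFun hv 3
  have h4 := congrFun hv 4
  simp [vecMul, dotProduct, Fin.sum_univ_five, altFive] at h0 h1 h2 h3 h4
  simp [subPfVec_apply_two, subPfVec_apply_three, altFive]
  linear_combination (-g) * h0 + (d) * h1 + (-a) * h4

/-- Left-kernel identity `(2,4)`: `v ᵥ* X = 0 ⟹ vᵢ Qⱼ = vⱼ Qᵢ` for the explicit alternating matrix.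
[folklore] -/
theorem altFive_lker_24 (a b c d e f g p q r : R) (v : Fin 5 → R)
    (hv : v ᵥ* altFive a b c d e f g p q r = 0) :
    v 2 * subPfVec (altFive a b c d e f g p q r) 4 = v 4 * subPfVec (altFive a b c d e f g p q r) 2 := by
  have h0 := congrFun hv 0
  have h1 := congrFun hv 1
  have h2 := congrFun hv 2
  have h3 := congrFun hv 3
  have h4 := congrFun hv 4
  simp [vecMul, dotProduct, Fin.sum_univ_five, altFive] at h0 h1 h2 h3 h4
  simp [subPfVec_apply_two, subPfVec_apply_four, altFive]
  linear_combination (f) * h0 + (-c) * h1 + (a) * h3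

/-- Left-kernel identity `(3,4)`: `v ᵥ* X = 0 ⟹ vᵢ Qⱼ = vⱼ Qᵢ` for the explicit alternating matrix.
[folklore] -/
theorem altFive_lker_34 (a b c d e f g p q r : R) (v : Fin 5 → R)
    (hv : v ᵥ* altFive a b c d e f g p q r = 0) :
    v 3 * subPfVec (altFive a b c d e f g p q r) 4 = v 4 * subPfVec (altFive a b c d e f g p q r) 3 := by
  have h0 := congrFun hv 0
  have h1 := congrFun hv 1
  have h2 := congrFun hv 2
  have h3 := congrFun hv 3
  have h4 := congrFun hv 4
  simp [vecMul, dotProduct, Fin.sum_univ_five, altFive] at h0 h1 h2 h3 h4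
  simp [subPfVec_apply_three, subPfVec_apply_four, altFive]
  linear_combination (-e) * h0 + (b) * h1 + (-a) * h2

/-- **Left-kernel lemma.** If `v ᵥ* X = 0` for an alternating `5 × 5` matrix `X`, then `v` is
parallel to `Q(X)`: `vᵢ Qⱼ = vⱼ Qᵢ` (an identity `vᵢQⱼ - vⱼQᵢ = (v ᵥ* X) ⬝ α⁽ⁱʲ⁾` with `α⁽ⁱʲ⁾` linear in
`X`; in particular the left kernel of `X` is the line through `Q(X)` when `Q(X) ≠ 0`). [folklore] -/
theorem mul_subPfVec_comm_of_vecMul_eq_zero {X : Matrix (Fin 5) (Fin 5) R} (hX : X ∈ altMatrix (Fin 5) R)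
    {v : Fin 5 → R} (hv : v ᵥ* X = 0) (i j : Fin 5) :
    v i * subPfVec X j = v j * subPfVec X i := by
  rw [eq_altFive_of_mem_altMatrix hX] at hv ⊢
  have h01 := altFive_lker_01 _ _ _ _ _ _ _ _ _ _ v hv
  have h02 := altFive_lker_02 _ _ _ _ _ _ _ _ _ _ v hv
  have h03 := altFive_lker_03 _ _ _ _ _ _ _ _ _ _ v hv
  have h04 := altFive_lker_04 _ _ _ _ _ _ _ _ _ _ v hv
  have h12 := altFive_lker_12 _ _ _ _ _ _ _ _ _ _ v hv
  have h13 := altFive_lker_13 _ _ _ _ _ _ _ _ _ _ v hv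
  have h14 := altFive_lker_14 _ _ _ _ _ _ _ _ _ _ v hv
  have h23 := altFive_lker_23 _ _ _ _ _ _ _ _ _ _ v hv
  have h24 := altFive_lker_24 _ _ _ _ _ _ _ _ _ _ v hv
  have h34 := altFive_lker_34 _ _ _ _ _ _ _ _ _ _ v hv
  fin_cases i <;> fin_cases j
  all_goals
    first
    | rfl
    | exact h01 | exact h02 | exact h03 | exact h04 | exact h12 | exact h13 | exact h14
    | exact h23 | exact h24 | exact h34
    | exact h01.symm | exact h02.symm | exact h03.symm | exact h04.symm | exact h12.symm
    | exact h13.symm | exact h14.symm | exact h23.symm | exact h24.symm | exact h34.symm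

/-- If `Q(X) ≠ 0` (so `X` has rank `4`), the left kernel of `X` is spanned by `Q(X)`. [folklore] -/
theorem exists_eq_smul_subPfVec_of_vecMul_eq_zero {K : Type*} [Field K] {X : Matrix (Fin 5) (Fin 5) K}
    (hX : X ∈ altMatrix (Fin 5) K) (hQ : subPfVec X ≠ 0) {v : Fin 5 → K} (hv : v ᵥ* X = 0) :
    ∃ c : K, v = c • subPfVec X := by
  obtain ⟨m, hm⟩ := Function.ne_iff.mp hQ
  have hm' : subPfVec X m ≠ 0 := hm
  refine ⟨v m / subPfVec X m, funext fun i => ?_⟩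
  have h := mul_subPfVec_comm_of_vecMul_eq_zero hX hv i m
  simp only [Pi.smul_apply, smul_eq_mul]
  rw [div_mul_eq_mul_div, eq_div_iff hm']
  linear_combination h

/-! ### No common left-kernel vector for a quadruple with independent quadrics -/

/-- If the five quadrics `Q₁(A), …, Q₅(A)` are linearly independent, the four alternating matrices
`A₁, …, A₄` have no common non-zero (left) kernel vector. [folklore] -/
theorem eq_zero_of_forall_vecMul_eq_zero {K : Type*} [Field K] (x : BhargavaQuinticSpace K)
    (hli : LinearIndependent K (fun i : Fin 5 => (subPfaffian x i : (Fin 4 → K) → K)))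
    {v : Fin 5 → K} (hv : ∀ i, v ᵥ* (x i : Matrix (Fin 5) (Fin 5) K) = 0) : v = 0 := by
  by_contra hne
  obtain ⟨a, ha⟩ := Function.ne_iff.mp hne
  -- `v` kills the whole pencil
  have hpen : ∀ t, v ᵥ* pencil x t = 0 := by
    intro t
    simp [pencil, vecMul_sum, vecMul_smul, hv]
  -- pick `b ≠ a`; then `v a • Q_b = v b • Q_a`, a non-trivial relation
  obtain ⟨b, hab⟩ : ∃ b : Fin 5, b ≠ a := ⟨a + 1, by simp⟩
  have hrel : ∀ t, v a * subPfaffian x b t = v b * subPfaffian x a t := fun t =>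
    mul_subPfVec_comm_of_vecMul_eq_zero (pencil_mem_altMatrix x t) (hpen t) a b
  classical
  have := (linearIndependent_iff'.mp hli) {a, b}
    (fun i => if i = b then v a else if i = a then -v b else 0) ?_ b (by simp)
  · simp at this
    exact ha this
  · rw [Finset.sum_pair hab.symm]
    simp only [if_neg hab.symm, if_true, hab, if_false]
    funext t
    simp only [Pi.add_apply, Pi.smul_apply, smul_eq_mul, Pi.zero_apply]
    rw [hrel t]
    ring

/-! ### Polynomial model of the five quadrics -/

section Poly

/-- Ring homomorphisms commute with `Q`. [folklore] -/
theorem map_subPfVec {S : Type*} [CommRing S] (φ : R →+* S) (X : Matrix (Fin 5) (Fin 5) R) (i : Fin 5) :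
    φ (subPfVec X i) = subPfVec (X.map φ) i := by
  simp [subPfVec, pf4, Matrix.submatrix_apply, Matrix.map_apply]

variable {K : Type*} [CommRing K]

/-- The pencil with polynomial coefficients `∑ Xᵢ Aᵢ ∈ M₅(K[X₀,…,X₃])`. [folklore] -/
def pencilPoly (x : BhargavaQuinticSpace K) : Matrix (Fin 5) (Fin 5) (MvPolynomial (Fin 4) K) :=
  ∑ i, (MvPolynomial.X i : MvPolynomial (Fin 4) K) •
    (x i : Matrix (Fin 5) (Fin 5) K).map (MvPolynomial.C : K →+* MvPolynomial (Fin 4) K)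

/-- Evaluating the polynomial pencil at `t` gives the pencil `A(t)`. [folklore] -/
theorem pencilPoly_map_eval (x : BhargavaQuinticSpace K) (t : Fin 4 → K) :
    (pencilPoly x).map (MvPolynomial.eval t) = pencil x t := by
  ext a b
  simp [pencilPoly, pencil, Matrix.sum_apply, Matrix.map_apply]

/-- The quadric `Qᵢ(A)` as a polynomial in `K[X₀, …, X₃]`. [folklore] -/
def subPfaffianPoly (x : BhargavaQuinticSpace K) (i : Fin 5) : MvPolynomial (Fin 4) K :=
  subPfVec (pencilPoly x) i

/-- `Qᵢ(A)(t)` is the evaluation of the polynomial `Qᵢ(A)` at `t`. [folklore] -/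
theorem eval_subPfaffianPoly (x : BhargavaQuinticSpace K) (i : Fin 5) (t : Fin 4 → K) :
    MvPolynomial.eval t (subPfaffianPoly x i) = subPfaffian x i t := by
  rw [subPfaffianPoly, map_subPfVec, pencilPoly_map_eval]
  rfl

end Poly

/-! ### The eigenvector lemma -/

/-- **Eigenvector lemma.** Let the five quadrics `Qᵢ(A)` be linearly independent over an infinite
field `K`, and let `N ∈ M₅(K)` be such that `N Q(A)(t)` is parallel to `Q(A)(t)` for every `t ∈ K⁴`.
Then `N` is a scalar.  (The image of `t ↦ Q(A)(t)` is not contained in a finite union of proper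
subspaces — the eigenspaces of `N` — because `K⁴` is irreducible: a product of non-zero polynomials
`φ_μ ∘ Q` does not vanish identically.) [folklore] -/
theorem exists_eq_smul_one_of_mulVec_parallel {K : Type*} [Field K] [Infinite K]
    (x : BhargavaQuinticSpace K)
    (hli : LinearIndependent K (fun i : Fin 5 => (subPfaffian x i : (Fin 4 → K) → K)))
    (N : Matrix (Fin 5) (Fin 5) K)
    (hN : ∀ (t : Fin 4 → K) (i j : Fin 5),
      (N *ᵥ fun m => subPfaffian x m t) i * subPfaffian x j t =
        (N *ᵥ fun m => subPfaffian x m t) j * subPfaffian x i t) :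
    ∃ ν : K, N = ν • (1 : Matrix (Fin 5) (Fin 5) K) := by
  classical
  by_contra hcon
  push Not at hcon
  let f : Module.End K (Fin 5 → K) := Matrix.toLin' N
  have hf : ∀ v, f v = N *ᵥ v := fun v => Matrix.toLin'_apply N v
  -- every eigenspace is a proper subspace
  have hprop : ∀ μ : K, f.eigenspace μ < ⊤ := by
    intro μ
    rw [lt_top_iff_ne_top]
    intro htop
    apply hcon μ
    apply Matrix.toLin'.injective
    apply LinearMap.ext
    intro v
    have hv : v ∈ f.eigenspace μ := by rw [htop]; exact Submodule.mem_top
    rw [Module.End.mem_eigenspace_iff] at hv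
    change f v = Matrix.toLin' (μ • (1 : Matrix (Fin 5) (Fin 5) K)) v
    rw [hv, Matrix.toLin'_apply, Matrix.smul_mulVec, Matrix.one_mulVec]
  -- functionals killing the eigenspaces
  choose φ hφ0 hφker using fun μ : K =>
    Submodule.exists_dual_map_eq_bot_of_lt_top (hprop μ) inferInstance
  -- the polynomials `G μ = φ_μ ∘ Q`
  let G : K → MvPolynomial (Fin 4) K := fun μ => ∑ i, φ μ (Pi.single i 1) • subPfaffianPoly x i
  have hφsum : ∀ (μ : K) (w : Fin 5 → K), φ μ w = ∑ i, φ μ (Pi.single i 1) * w i := by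
    intro μ w
    rw [LinearMap.pi_apply_eq_sum_univ (φ μ) w]
    refine Finset.sum_congr rfl fun i _ => ?_
    rw [smul_eq_mul, mul_comm]
    congr 2
    funext j
    simp [Pi.single_apply, eq_comm]
  have hGeval : ∀ (μ : K) (t : Fin 4 → K),
      MvPolynomial.eval t (G μ) = φ μ (fun m => subPfaffian x m t) := by
    intro μ t
    rw [hφsum]
    simp [G, map_sum, eval_subPfaffianPoly]
  have hGne : ∀ μ, G μ ≠ 0 := by
    intro μ hG
    apply hφ0 μ
    have hcoef : ∀ i, φ μ (Pi.single i 1) = 0 := by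
      have hfun : ∑ i, φ μ (Pi.single i 1) • (subPfaffian x i : (Fin 4 → K) → K) = 0 := by
        funext t
        have := hGeval μ t
        rw [hG, map_zero, hφsum] at this
        simp only [Finset.sum_apply, Pi.smul_apply, smul_eq_mul, Pi.zero_apply]
        exact this.symm
      exact fun i => Fintype.linearIndependent_iff.mp hli _ hfun i
    apply LinearMap.ext
    intro w
    rw [hφsum, LinearMap.zero_apply]
    simp [hcoef]
  -- the polynomial `Q₀ · Π_μ G μ` is non-zero, hence non-zero at some `t₀`
  have hfin : Set.Finite {μ : K | f.HasEigenvalue μ} := f.finite_hasEigenvalue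
  have hQ0ne : subPfaffianPoly x 0 ≠ 0 := by
    intro h0
    have hfun : (subPfaffian x 0 : (Fin 4 → K) → K) = 0 := by
      funext t
      rw [← eval_subPfaffianPoly, h0, map_zero, Pi.zero_apply]
    exact hli.ne_zero 0 hfun
  let P : MvPolynomial (Fin 4) K := subPfaffianPoly x 0 * ∏ μ ∈ hfin.toFinset, G μ
  have hP : P ≠ 0 := mul_ne_zero hQ0ne (Finset.prod_ne_zero_iff.mpr fun μ _ => hGne μ)
  obtain ⟨t₀, ht₀⟩ : ∃ t, MvPolynomial.eval t P ≠ 0 := by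
    by_contra hall
    push Not at hall
    exact hP (MvPolynomial.funext fun t => by rw [hall t, map_zero])
  rw [map_mul, map_prod] at ht₀
  have hw0 : subPfaffian x 0 t₀ ≠ 0 := by
    intro h
    apply ht₀
    rw [eval_subPfaffianPoly, h, zero_mul]
  -- `w = Q(t₀) ≠ 0` is an eigenvector of `N`
  set w : Fin 5 → K := fun m => subPfaffian x m t₀ with hw_def
  have hwne : w ≠ 0 := fun h => hw0 (congrFun h 0)
  let μ : K := (N *ᵥ w) 0 / w 0
  have hmem : w ∈ f.eigenspace μ := by
    rw [Module.End.mem_eigenspace_iff, hf]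
    funext i
    have := hN t₀ i 0
    simp only [Pi.smul_apply, smul_eq_mul]
    change (N *ᵥ w) i = (N *ᵥ w) 0 / w 0 * w i
    rw [div_mul_eq_mul_div, eq_div_iff hw0]
    linear_combination this
  have hμ : f.HasEigenvalue μ := Module.End.hasEigenvalue_of_hasEigenvector ⟨hmem, hwne⟩
  -- the factor `G μ` vanishes at `t₀`
  apply ht₀
  have hzero : MvPolynomial.eval t₀ (G μ) = 0 := by
    rw [hGeval]
    have hker : f.eigenspace μ ≤ LinearMap.ker (φ μ) := LinearMap.le_ker_iff_map.mpr (hφker μ)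
    exact hker hmem
  rw [Finset.prod_eq_zero (hfin.mem_toFinset.mpr hμ) hzero, mul_zero]

end BhargavaQuinticSpace
end Literature.NumberTheory.NumberFields
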